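import Summits.QuantumFields.BalabanUV.T4Continuum.Support.VariationalVectorEndOfLeavesSlice
import Summits.QuantumFields.BalabanUV.T4Continuum.Support.VariationalAssemblySliceMin

/-!
# T⁴ programme, spine node NE2 (U1a), lane P2 — THE VECTOR END MODULO THE LEAVES WITH THE TWO `G`-BINDERS LOCALISED AT MINIMISERS
# ((SLICE-min) and (ONE-min) of leaf-01-g7's `VariationalAssemblySliceMin`, p≥224xxx; model level; cell `pub-balaban`)

NE2 formalisation swarm `b2b-balaban-t4-ne2-formalise-*`, leaf prover 10 GEN 3 (`prover-b2b-balaban-t4-ne2-formalise-leaf-10-g3-0`, lineage V-COMP TOWER ∕ V-END);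
journal «MINE» + INTENT CLAIMS.log 2026-08-20 15:50Z l.16551, answering leaf-01-g7's OFFER l.16452 ∕ NOTE l.16520.  CREDIT: the proof below is leaf-01-g7's draft
`HOME/b2b-balaban-t4-ne2-formalise-leaf-01/g7/VariationalVectorEndOfLeavesMin.v0.draft.lean` (itself = this lineage's `towerLimitRate_effV_of_leaves_slice`, p221732,
with two socket lines changed), adopted with the namespace made file-local; nothing defined.  A sibling of `VariationalVectorEndOfLeavesSlice.towerLimitRate_effV_of_leaves_slice`
(p221732) — the SAME proof (its rate lemma `eSlice_level_le`, p220074's `ePV_level_le` ∕ §2 binders, `VariationalVectorTower.towerLimitRate_effV_of_pairs` p218948, BY NAME),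
with the per-level bracket `VariationalAssemblySlice.vector_pair_bracket_sqrt_slice_line` (p220652) replaced by leaf-01-g7's
`VariationalAssemblySliceMin.vector_pair_bracket_sqrt_min_line`.

THE TWO CHANGED SOCKETS (leaf-01-g7's memo `t4/T4-EST-NE2-P2-VGF.md`; leaf-09-g7's located remarks CLAIMS.log 2026-08-20 (i) 15:15Z and (3) 15:26Z):
 * `hslice k` ↦ **(SLICE-min)** — the slice law ONLY at the one-step average `QvL (T′ k) g₀` of a fine minimiser `g₀` of the composite fibre (the only place the bracket
   uses it).  With background the unrestricted slice constant is measured level-INDEPENDENT (`σ⋆ ≈ 0.16·c`, the commutator cost of `VariationalVectorGaugeMove` p223848 —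
   a located obstruction to `σ k ≤ c_σ θ^k` as a `∀ W` law), the restricted one `≈ 10⁻³·c⁴` (memo §3; numerics, not a theorem);
 * `hONE k` ↦ **(ONE-min)** — leaf V-ONE ONLY at a coarse minimiser `W₀` of the level-`k` fibre and INTO THE COMPOSITE FIBRE, full fine form:
   `∃ g, QvL (T k) (QvL (T′ k) g) = φ ∧ SfV (R′ k) (G′ k) g ≤ (√(ScV (R k) (G k) W₀ + ε₁ k·ρV k W₀) + δ′ k·√(qWV W₀))²`.  At flat data this socket IS inhabited
   (leaf-01-g7's `VariationalAssemblySliceMinFlat.hONEm_tower`: leaf-01-g6's competitor p220658 + leaf-09-g7's `slice_flat` p222324 one level up), whereas p221732's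
   one-step-fibre `hONE k` for the full fine form has NO k-uniform inhabitant there once `k ≥ 1` (this lineage's `VariationalVectorBlockSpinGap`, NOTE N-ne2leaf01g6-1);
and the one-step surjectivity `hsurj₁` is no longer needed.  Conclusion and constant VERBATIM as in p221732:
  **`towerLimitRate_effV_of_leaves_min`**: `TowerLimitRate (fun _ ↦ 1) 1 (k ↦ effV (L^k) M (R k) (Gm k) (QmL (L^k) M (T k)) a) C θ`,
  `C = eV Λ⋆ C_P⋆ c_δ + c_σ′·(Λ⋆ + eV Λ⋆ C_P⋆ c_δ) + c_σ·(C_P⋆(Λ⋆+1)) + ePV Λ⋆ C_P⋆ C_R⋆ c_ε c_δ′`.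
The flat instance («U = 1 vector END modulo V-REG only», and CLOSED once leaf-03-g5's `hREG_flat_closed` is in the tree) is the next file `VariationalVectorEndFlatMin`.
SOCKETS BY NAME: `hUBc`∕`hUBf` ← V-UB (p218278; flat: leaf-09-g7 `hUBc_tower`∕`hUBf_tower` p223319); `hPc`∕`hPf` ← V-P (p219068 + p218347 ∕ p219305; flat: `hPc_tower`∕`hPf_tower`
p222627); `hFEDcurl` ← `VariationalVectorFederbushPhys.ScV_QvL_le_curl` (p217269; flat: `hFEDcurl_tower` p223421); `hslice` ← V-GF (OPEN with background; flat: `hsliceMin_tower`);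
`hONEm` ← V-ONE (p219670 ∕ p220658; flat: `hONEm_tower`); `hREG` ← V-REG (leaf-03-g5: `hREG_rhoV` p222597 under displayed (Går)∕V-P∕V-UB; flat: `hREG_flat_closed`).

HONEST FRAMING (T4-DAG p. 1).  Model level, `E = ℂ`; transports ∕ forms ∕ functionals DATA (no identification with Bałaban's objects — c5); [folklore] plumbing + real
arithmetic over tree theorems imported BY NAME; every leaf DISPLAYED, none discharged here; nothing printed is a hypothesis; no `def`, no `def … : Prop`, no `sorry`;
axioms standard.  V-GF with background OPEN; V-END ∕ NE2 NOT proved; NE3 OPEN; spine PROVED 0∕9 unchanged; rung (B)+1 finite T⁴ — NOT infinite volume, NOT mass gap,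
NOT Clay.  HONEST DEPENDENCY (cell, verbatim): continuum YM on T⁴ ⇐ BetaPertH ∧ nine spine estimates (0/9 proved); BetaPertH ⇐ (D1) ∧ (D4) ∧ CAP+tail; G-an2-4 gates
asym, D1 and NE2/3/4.
-/

noncomputable section

namespace Summit.QuantumFields.BalabanUV.T4Continuum.VariationalVectorEndOfLeavesMin

open Finset
open scoped Matrix ComplexConjugate ComplexOrder Matrix.Norms.L2Operator BigOperators
open Literature.MathematicalPhysics.QuantumFieldTheory.Balaban1983to89.B5Prop11Plancherel (Tor fine unitVec)
open Literature.Analysis.Complex (qform)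
open Summit.QuantumFields.BalabanUV.T4Continuum.VariationalTransfer (blockSpin)
open Summit.QuantumFields.BalabanUV.T4Continuum.VariationalColourTower (Rtrv)
open Summit.QuantumFields.BalabanUV.T4Continuum.CovariantAveragingTower (TowerLimitRate)
open Summit.QuantumFields.BalabanUV.T4Continuum.VectorBlockTrialForm (nsqV nsqV_nonneg QvL compL)
open Summit.QuantumFields.BalabanUV.T4Continuum.VariationalVectorForm
open Summit.QuantumFields.BalabanUV.T4Continuum.VariationalVectorEffective (unc effV)
open Summit.QuantumFields.BalabanUV.T4Continuum.VariationalVectorAverage (continuous_QvL)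
open Summit.QuantumFields.BalabanUV.T4Continuum.VariationalVectorTower (Gtr QmL QvL_surjective_of_ub towerLimitRate_effV_of_pairs)
open Summit.QuantumFields.BalabanUV.T4Continuum.VariationalVectorEndOfLeaves
  (eV ePV eV_nonneg ePV_nonneg ePV_level_le eSlice_level_le nonneg_of_qform continuous_of_qform nonneg_of_Gtr continuous_of_Gtr)
open Summit.QuantumFields.BalabanUV.T4Continuum.VariationalAssemblySliceMin (vector_pair_bracket_sqrt_min_line)

variable {d : ℕ}

section Tower

variable (L : ℕ) [NeZero L] (M : Fin d → ℕ) [hM : ∀ μ, NeZero (M μ)]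
variable (R : (k : ℕ) → Tor (fine (L ^ k) M) → Fin d → (ℂ →L[ℂ] ℂ))
variable (R' : (k : ℕ) → Tor (fine L (fine (L ^ k) M)) → Fin d → (ℂ →L[ℂ] ℂ))
variable (Gm : (k : ℕ) → Matrix (Tor (fine (L ^ k) M) × Fin d) (Tor (fine (L ^ k) M) × Fin d) ℂ)
variable (G : (k : ℕ) → (Tor (fine (L ^ k) M) → Fin d → ℂ) → ℝ)
variable (G' : (k : ℕ) → (Tor (fine L (fine (L ^ k) M)) → Fin d → ℂ) → ℝ)
variable (T : (k : ℕ) → Tor M → (Fin d → Fin (L ^ k)) → Fin (L ^ k) → Fin d → (ℂ →L[ℂ] ℂ))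
variable (T' : (k : ℕ) → Tor (fine (L ^ k) M) → (Fin d → Fin L) → Fin L → Fin d → (ℂ →L[ℂ] ℂ))

/-- **THE VECTOR END OF ROAD P2 MODULO THE LEAVES — `G`-BINDERS LOCALISED AT MINIMISERS.**  As `towerLimitRate_effV_of_leaves_slice` (p221732) with `hslice k` ↦
(SLICE-min) (the slice law only at one-step averages of fine minimisers of the composite fibre) and `hONE k` ↦ (ONE-min) (leaf V-ONE only at coarse minimisers, into the
COMPOSITE fibre, full fine form); no `hsurj₁`; everything else — structural binders, COMP DATA identities, contractive `T′ k`, V-UB ∕ V-P ∕ curl Federbush ∕ V-REG displayed,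
uniform constants, decay `δ, ε₁, δ′, σ, σ′ ≤ c·θ^k`, `0 ≤ θ < 1`, `0 < a` — and the conclusion with its constant VERBATIM. [folklore] -/
theorem towerLimitRate_effV_of_leaves_min (hGm : ∀ k, (Gm k).PosSemidef) (hG : ∀ k W, G k W = qform (Gm k) (unc W))
    (hTcomp : ∀ k, T (k + 1) = compL (L ^ k) L M (T k) (T' k)) (hRtr : ∀ k, R (k + 1) = Rtrv (L ^ k) L M (R' k))
    (hGtr : ∀ k, G (k + 1) = Gtr (L ^ k) L M (G' k))
    (hT'1 : ∀ k y j t μ, ‖T' k y j t μ‖ ≤ 1)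
    {a : ℝ} (ha : 0 < a)
    (Λ CP CR δ ε₁ δ' σ σ' : ℕ → ℝ) {Λs CPs CRs cδ cε cδ' cσ cσ' θ : ℝ}
    (hΛ : ∀ k, 0 ≤ Λ k) (hΛs : ∀ k, Λ k ≤ Λs) (hCP : ∀ k, 0 ≤ CP k) (hCPs : ∀ k, CP k ≤ CPs) (hCR : ∀ k, 0 ≤ CR k) (hCRs : ∀ k, CR k ≤ CRs)
    (hδ : ∀ k, 0 ≤ δ k) (hε₁ : ∀ k, 0 ≤ ε₁ k) (hδ' : ∀ k, 0 ≤ δ' k) (hσ : ∀ k, 0 ≤ σ k) (hσ' : ∀ k, 0 ≤ σ' k) (hθ : 0 ≤ θ) (hθ1 : θ < 1)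
    (hδθ : ∀ k, δ k ≤ cδ * θ ^ k) (hεθ : ∀ k, ε₁ k ≤ cε * θ ^ k) (hδ'θ : ∀ k, δ' k ≤ cδ' * θ ^ k)
    (hσθ : ∀ k, σ k ≤ cσ * θ ^ k) (hσ'θ : ∀ k, σ' k ≤ cσ' * θ ^ k)
    {ρV : (k : ℕ) → (Tor (fine (L ^ k) M) → Fin d → ℂ) → ℝ} (hρ0 : ∀ k W, 0 ≤ ρV k W)
    -- leaf V-UB at both levels
    (hUBc : ∀ k (φ : Tor M → Fin d → ℂ), ∃ W, QvL (L ^ k) M (T k) W = φ ∧ ScV (L ^ k) M (R k) (G k) W ≤ Λ k * nsqV M φ)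
    (hUBf : ∀ k (φ : Tor M → Fin d → ℂ), ∃ W', QvL (L ^ k) M (T k) (QvL L (fine (L ^ k) M) (T' k) W') = φ ∧
      SfV (L ^ k) L M (R' k) (G' k) W' ≤ Λ k * nsqV M φ)
    -- leaf V-P at both levels
    (hPc : ∀ k W, qWV (L ^ k) M W ≤ CP k * (ScV (L ^ k) M (R k) (G k) W + nsqV M (QvL (L ^ k) M (T k) W)))
    (hPf : ∀ k W', qVV (L ^ k) L M W' ≤ CP k * (SfV (L ^ k) L M (R' k) (G' k) W' + nsqV M (QvL (L ^ k) M (T k) (QvL L (fine (L ^ k) M) (T' k) W'))))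
    -- the CURL Federbush against the pure-curl fine form, and the SLICE AT AVERAGED FINE MINIMISERS
    (hFEDcurl : ∀ k W', ScV (L ^ k) M (R k) (fun _ => 0) (QvL L (fine (L ^ k) M) (T' k) W')
      ≤ (Real.sqrt (SfV (L ^ k) L M (R' k) (fun _ => 0) W') + δ k * Real.sqrt (qVV (L ^ k) L M W')) ^ 2)
    (hslice : ∀ k (φ : Tor M → Fin d → ℂ) (g₀ : Tor (fine L (fine (L ^ k) M)) → Fin d → ℂ),
      QvL (L ^ k) M (T k) (QvL L (fine (L ^ k) M) (T' k) g₀) = φ →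
      (∀ W', QvL (L ^ k) M (T k) (QvL L (fine (L ^ k) M) (T' k) W') = φ → SfV (L ^ k) L M (R' k) (G' k) g₀ ≤ SfV (L ^ k) L M (R' k) (G' k) W') →
      ∃ Ws, QvL (L ^ k) M (T k) Ws = φ ∧
        ScV (L ^ k) M (R k) (G k) Ws ≤ ScV (L ^ k) M (R k) (fun _ => 0) (QvL L (fine (L ^ k) M) (T' k) g₀)
          + σ' k * ScV (L ^ k) M (R k) (fun _ => 0) (QvL L (fine (L ^ k) M) (T' k) g₀) + σ k * qWV (L ^ k) M (QvL L (fine (L ^ k) M) (T' k) g₀))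
    -- leaf V-ONE AT COARSE MINIMISERS INTO THE COMPOSITE FIBRE (square-root shape), and leaf V-REG
    (hONEm : ∀ k (φ : Tor M → Fin d → ℂ) (W₀ : Tor (fine (L ^ k) M) → Fin d → ℂ), QvL (L ^ k) M (T k) W₀ = φ →
      (∀ W, QvL (L ^ k) M (T k) W = φ → ScV (L ^ k) M (R k) (G k) W₀ ≤ ScV (L ^ k) M (R k) (G k) W) →
      ∃ g, QvL (L ^ k) M (T k) (QvL L (fine (L ^ k) M) (T' k) g) = φ ∧
        SfV (L ^ k) L M (R' k) (G' k) g ≤ (Real.sqrt (ScV (L ^ k) M (R k) (G k) W₀ + ε₁ k * ρV k W₀) + δ' k * Real.sqrt (qWV (L ^ k) M W₀)) ^ 2)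
    (hREG : ∀ k (φ : Tor M → Fin d → ℂ) W, QvL (L ^ k) M (T k) W = φ →
      (∀ W₂, QvL (L ^ k) M (T k) W₂ = φ → ScV (L ^ k) M (R k) (G k) W ≤ ScV (L ^ k) M (R k) (G k) W₂) →
      ρV k W ≤ CR k * (ScV (L ^ k) M (R k) (G k) W + nsqV M φ)) :
    TowerLimitRate (ι := fun _ => Tor M × Fin d) (fun _ => (1 : Matrix (Tor M × Fin d) (Tor M × Fin d) ℂ)) 1
      (fun k => effV (L ^ k) M (R k) (Gm k) (QmL (L ^ k) M (T k)) a)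
      (eV Λs CPs cδ + cσ' * (Λs + eV Λs CPs cδ) + cσ * (CPs * (Λs + 1)) + ePV Λs CPs CRs cε cδ') θ := by
  -- (GF0) and continuity at every level, from the matrix form and one step up through `Gtr`
  have hG0 : ∀ k W, 0 ≤ G k W := fun k => nonneg_of_qform (L ^ k) M (hGm k) (hG k)
  have hGc : ∀ k, Continuous (G k) := fun k => continuous_of_qform (L ^ k) M (hG k)
  have hG0' : ∀ k W', 0 ≤ G' k W' := fun k => nonneg_of_Gtr (L ^ k) L M (hGtr k) (hG0 (k + 1))
  have hGc' : ∀ k, Continuous (G' k) := fun k => continuous_of_Gtr (L ^ k) L M (hGtr k) (hGc (k + 1))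
  -- the starred constants are nonnegative (level 0)
  have hθ1' : θ ≤ 1 := hθ1.le
  have hΛs0 : 0 ≤ Λs := (hΛ 0).trans (hΛs 0)
  have hCPs0 : 0 ≤ CPs := (hCP 0).trans (hCPs 0)
  have hCRs0 : 0 ≤ CRs := (hCR 0).trans (hCRs 0)
  have hcδ : 0 ≤ cδ := by have := (hδ 0).trans (hδθ 0); simpa using this
  have hcε : 0 ≤ cε := by have := (hε₁ 0).trans (hεθ 0); simpa using this
  have hcδ' : 0 ≤ cδ' := by have := (hδ' 0).trans (hδ'θ 0); simpa using this
  have hcσ : 0 ≤ cσ := by have := (hσ 0).trans (hσθ 0); simpa using this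
  have hcσ' : 0 ≤ cσ' := by have := (hσ' 0).trans (hσ'θ 0); simpa using this
  have hE0 : 0 ≤ eV Λs CPs cδ := eV_nonneg hΛs0 hCPs0 hcδ
  have hEP0 : 0 ≤ ePV Λs CPs CRs cε cδ' := ePV_nonneg hΛs0 hCPs0 hCRs0 hcε hcδ'
  have hS0 : 0 ≤ eV Λs CPs cδ + cσ' * (Λs + eV Λs CPs cδ) + cσ * (CPs * (Λs + 1)) := by positivity
  have hC : 0 ≤ eV Λs CPs cδ + cσ' * (Λs + eV Λs CPs cδ) + cσ * (CPs * (Λs + 1)) + ePV Λs CPs CRs cε cδ' := add_nonneg hS0 hEP0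
  -- per-level rates of the two defects
  have he : ∀ k, eV (Λ k) (CP k) (δ k) + σ' k * (Λ k + eV (Λ k) (CP k) (δ k)) + σ k * (CP k * (Λ k + 1))
      ≤ (eV Λs CPs cδ + cσ' * (Λs + eV Λs CPs cδ) + cσ * (CPs * (Λs + 1)) + ePV Λs CPs CRs cε cδ') * θ ^ k := fun k => by
    have h1 := eSlice_level_le k (hΛ k) (hΛs k) (hCP k) (hCPs k) (hδ k) hcδ hcσ hcσ' hθ hθ1' (hδθ k) (hσθ k) (hσ'θ k)
    have h2 : 0 ≤ ePV Λs CPs CRs cε cδ' * θ ^ k := mul_nonneg hEP0 (pow_nonneg hθ k)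
    linarith [add_mul (eV Λs CPs cδ + cσ' * (Λs + eV Λs CPs cδ) + cσ * (CPs * (Λs + 1))) (ePV Λs CPs CRs cε cδ') (θ ^ k)]
  have he' : ∀ k, ePV (Λ k) (CP k) (CR k) (ε₁ k) (δ' k)
      ≤ (eV Λs CPs cδ + cσ' * (Λs + eV Λs CPs cδ) + cσ * (CPs * (Λs + 1)) + ePV Λs CPs CRs cε cδ') * θ ^ k := fun k => by
    have h1 := ePV_level_le k (hΛ k) (hΛs k) (hCP k) (hCPs k) (hCR k) (hCRs k) (hε₁ k) hcε (hδ' k) hcδ' hθ hθ1' (hεθ k) (hδ'θ k)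
    have h2 : 0 ≤ (eV Λs CPs cδ + cσ' * (Λs + eV Λs CPs cδ) + cσ * (CPs * (Λs + 1))) * θ ^ k := mul_nonneg hS0 (pow_nonneg hθ k)
    linarith [add_mul (eV Λs CPs cδ + cσ' * (Λs + eV Λs CPs cδ) + cσ * (CPs * (Λs + 1))) (ePV Λs CPs CRs cε cδ') (θ ^ k)]
  -- the localised brackets, level by level, fed to the pair-to-rate currency
  exact towerLimitRate_effV_of_pairs L M R R' Gm G G' T T' hGm hG (fun k => QvL_surjective_of_ub (L ^ k) M (hUBc k)) hPc hTcomp hRtr hGtr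
    ha hC hθ hθ1 (fun k => eV (Λ k) (CP k) (δ k) + σ' k * (Λ k + eV (Λ k) (CP k) (δ k)) + σ k * (CP k * (Λ k + 1)))
    (fun k => ePV (Λ k) (CP k) (CR k) (ε₁ k) (δ' k)) he he'
    fun k φ => vector_pair_bracket_sqrt_min_line (L ^ k) L M (continuous_QvL (L ^ k) M (T k)) (hT'1 k) (hG0 k) (hGc k) (hG0' k)
      (hGc' k) (hΛ k) (hCP k) (hCR k) (hδ k) (hε₁ k) (hδ' k) (hσ k) (hσ' k) (hρ0 k) (hUBc k) (hUBf k) (hPc k) (hPf k) (hFEDcurl k)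
      (hslice k) (hONEm k) (hREG k) φ

end Tower

end Summit.QuantumFields.BalabanUV.T4Continuum.VariationalVectorEndOfLeavesMin

end
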